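import Summits.CriticalPhenomena.PercolationContinuityZ3.Theorems.PercNearOneGluingNoHeavyLowerTailAPLShortcutParallel
import Summits.CriticalPhenomena.PercolationContinuityZ3.Theorems.PercNearOneGluingNoHeavyLowerTailAPLBeadChain
import HarnessLib

/-!
# `NoHeavyLowerTail` (stmt-CriticalPhenomena-4575) — LADDER NETWORKS I: the two elementary moves of the sharpness family for the
# series–parallel theorem (`E ≤ 28/27`), at the `PrW` level

Support file (prover prim-ineq-gen-8 gen 61; `--supports stmt-CriticalPhenomena-4575`; memo
run/shared/lean/prim/prim-ineq-gen-8/FINDING-gen61-SPTHEOREM.md §2).  No definitions, no named facts, no sorries.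

Setting of `…APLSeriesReduction` / `…APLShortcutParallel`: weights `p` on `Sym2 V`, finite weighted probabilities `DecisionTree.PrW D p` of
cluster events (`Gladkov.cl`), a distinguished vertex `g` and two ports `u, v` of an edge set `R`, and the four numbers
`p = P(u ∈ cl g)`, `π = P(v ∈ cl g)`, `τ = P(u, v ∈ cl g)`, `m = P(u ∉ cl g, v ∈ cl u)` (so `s := m + τ = P(v ∈ cl u)`).
The extremal family of the series–parallel theorem (`sp_E_le`, file `…APLSeriesParallel`) is built from two moves on the CORE network
(the vertex `g` will carry the pendant apex edge at the very end):
* `edge_conn` — `P(y ∈ cl x) = p_{xy}` for the single edge `{s(x,y)}`;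
* **`rail_u_p/pi/tau/m`** — A RAIL AT THE PORT `u`: for a fresh vertex `u'` and the new edge `s(u', u)` of weight `c`, the numbers of
  `(g; u', v)` on `{s(u',u)} ∪ R` are `(c·p, π, c·τ, c·m)` (series laws `series_p/pi/tau/m` with the one-edge piece);
* **`rail_v_p/pi/tau/m`** — the mirror rail `s(v', v)` at the port `v`: `(p, c·π, c·τ, c·m)` on `R ∪ {s(v',v)}`;
* **`rung_p/pi/tau/m`** — A RUNG BETWEEN THE PORTS: for the new edge `s(u, v)` of weight `w`, the numbers of `(g; u, v)` on `R ∪ {s(u,v)}` are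
  `p + w(π − τ)`, `π + w(p − τ)`, `τ + w(p + π − 2τ)`, `m + w(1 − p − π + τ − m)` (union lemma `glued_cell_*` with the `g`-free piece,
  exactly as in `shortcut_parallel`).
In the scale-free variables `x = p/τ`, `y = π/τ`, `s = m + τ` one has `E := τ²/(pπ s) = 1/(xys)`; the rails divide `y` resp. `x` by `c` and
multiply `s` by `c`, the rung is the shortcut map — the balanced schedule of `…APLLadderSharpness` keeps `x = y = 3/2` and drives `E` to
`28/27 − 16w²/(27(3+w)²)`. [this work]
-/

namespace Summit.CriticalPhenomena.PercolationContinuityZ3.Theorems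

namespace APL

open Literature.Probability.Percolation Literature.Probability.Percolation.Gladkov Literature.Probability.Percolation.DecisionTree
open scoped Classical

variable {V : Type*} [Fintype V]

/-- The single edge `{s(x,y)}` joins `x` to `y` with probability its weight: `P(y ∈ cl x) = p s(x,y)` (`x ≠ y`). [folklore] -/
theorem edge_conn (p : Sym2 V → ℝ) (x y : V) (hxy : x ≠ y) :
    PrW ({s(x, y)} : Finset (Sym2 V)) p {K : Finset (Sym2 V) | y ∈ cl K x} = p s(x, y) := by
  have h1 : y ∈ cl ({s(x, y)} : Finset (Sym2 V)) x :=
    mem_cl_of_adj (mem_cl_self _ _) (adj_iff.2 ⟨Finset.mem_singleton_self _, hxy⟩)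
  have h0 : y ∉ cl (∅ : Finset (Sym2 V)) x := pendant_not_mem_cl (fun f hf => absurd hf (Finset.notMem_empty f)) hxy.symm
  rw [PrW_single_edge]
  simp [ind, h1, h0]

/-- Port swap of the `m`-event: `P(v ∉ cl g, u ∈ cl v) = P(u ∉ cl g, v ∈ cl u)` (both say: the ports are joined to each other and not
to `g`). [folklore] -/
theorem m_event_comm (p : Sym2 V → ℝ) (D : Finset (Sym2 V)) (g u v : V) :
    PrW D p {K : Finset (Sym2 V) | v ∉ cl K g ∧ u ∈ cl K v} = PrW D p {K : Finset (Sym2 V) | u ∉ cl K g ∧ v ∈ cl K u} := by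
  refine PrW_congr_set D p fun K _ => ?_
  simp only [Set.mem_setOf_eq]
  constructor
  · rintro ⟨hvg, huv⟩
    exact ⟨fun hug => hvg (ThreePointLB.mem_cl_trans hug (mem_cl_comm.1 huv)), mem_cl_comm.1 huv⟩
  · rintro ⟨hug, hvu⟩
    exact ⟨fun hvg => hug (ThreePointLB.mem_cl_trans hvg (mem_cl_comm.1 hvu)), mem_cl_comm.1 hvu⟩

/-- `P(v, u ∈ cl g) = P(u, v ∈ cl g)`. [folklore] -/
theorem both_comm (p : Sym2 V → ℝ) (D : Finset (Sym2 V)) (g u v : V) :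
    PrW D p {K : Finset (Sym2 V) | v ∈ cl K g ∧ u ∈ cl K g} = PrW D p {K : Finset (Sym2 V) | u ∈ cl K g ∧ v ∈ cl K g} :=
  PrW_congr_set D p fun K _ => by simp only [Set.mem_setOf_eq]; exact And.comm

/-! ### A rail at a port -/

omit [Fintype V] in
/-- A fresh rail edge `s(u', u)` (`u'` off `R`) is not an edge of `R`. [folklore] -/
theorem rail_disjoint (R : Finset (Sym2 V)) (u u' : V) (hu' : ∀ e ∈ R, u' ∉ e) : Disjoint ({s(u', u)} : Finset (Sym2 V)) R :=
  Finset.disjoint_singleton_left.2 fun h => hu' _ h (Sym2.mem_mk_left _ _)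

omit [Fintype V] in
/-- A vertex of the fresh rail edge `s(u', u)` lying on `R` is `u` (so it is `g` or `u`). [folklore] -/
theorem rail_sep (R : Finset (Sym2 V)) (g u u' : V) (hu' : ∀ e ∈ R, u' ∉ e) :
    ∀ x : V, (∃ e ∈ ({s(u', u)} : Finset (Sym2 V)), x ∈ e) → (∃ e ∈ R, x ∈ e) → (x = g ∨ x = u) := by
  rintro x ⟨e, he, hxe⟩ ⟨f, hf, hxf⟩
  rw [Finset.mem_singleton] at he
  subst he
  rcases Sym2.mem_iff.1 hxe with rfl | rfl
  · exact absurd hxf (hu' f hf)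
  · exact Or.inr rfl

omit [Fintype V] in
/-- The other port `v ∉ {u', u}` does not lie on the rail edge. [folklore] -/
theorem rail_off (u v u' : V) (hu'v : u' ≠ v) (huv : u ≠ v) :
    ∀ e ∈ ({s(u', u)} : Finset (Sym2 V)), v ∈ e → v = u := fun e he hve => by
  rw [Finset.mem_singleton] at he
  subst he
  rcases Sym2.mem_iff.1 hve with h | h
  · exact absurd h hu'v.symm
  · exact absurd h huv.symm

/-- The one-edge piece `(g; u', u)` on `{s(u',u)}` (`g ∉ {u', u}`): `P(u' ∈ cl g) = P(u ∈ cl g) = P(u', u ∈ cl g) = 0` and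
`P(u' ∉ cl g, u ∈ cl u') = c := p s(u',u)`. [folklore] -/
theorem rail_piece (p : Sym2 V → ℝ) (g u u' : V) (hu'g : u' ≠ g) (hu'u : u' ≠ u) (hug : u ≠ g) :
    PrW ({s(u', u)} : Finset (Sym2 V)) p {K : Finset (Sym2 V) | u' ∈ cl K g} = 0
    ∧ PrW ({s(u', u)} : Finset (Sym2 V)) p {K : Finset (Sym2 V) | u ∈ cl K g} = 0
    ∧ PrW ({s(u', u)} : Finset (Sym2 V)) p {K : Finset (Sym2 V) | u' ∈ cl K g ∧ u ∈ cl K g} = 0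
    ∧ PrW ({s(u', u)} : Finset (Sym2 V)) p {K : Finset (Sym2 V) | u' ∉ cl K g ∧ u ∈ cl K u'} = p s(u', u) := by
  have hD : ∀ f ∈ ({s(u', u)} : Finset (Sym2 V)), g ∉ f := fun f hf hg => by
    rw [Finset.mem_singleton] at hf
    subst hf
    rcases Sym2.mem_iff.1 hg with h | h
    · exact hu'g h.symm
    · exact hug h.symm
  refine ⟨apexFree_p p _ hD hu'g, apexFree_p p _ hD hug, afree_cell_three p _ g u' u hu'g hD, ?_⟩
  rw [m_event_eq_cell p _ g u' u, afree_cell_bc p _ g u' u hu'g hug hD, edge_conn p u' u hu'u]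

/-- **Rail at the port `u`**: for a fresh vertex `u'` (off `R`, `≠ g, u, v`) and the rail edge `s(u', u)` of weight `c`, the four numbers of
`(g; u', v)` on `{s(u',u)} ∪ R` are `(c·p, π, c·τ, c·m)` in terms of those of `(g; u, v)` on `R` (series laws with the one-edge piece
`rail_piece`). [this work] -/
theorem rail_u (p : Sym2 V → ℝ) (R : Finset (Sym2 V)) (g u v u' : V) (hu' : ∀ e ∈ R, u' ∉ e) (hu'g : u' ≠ g) (hu'u : u' ≠ u)
    (hu'v : u' ≠ v) (hug : u ≠ g) (hvg : v ≠ g) (huv : u ≠ v) :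
    PrW ({s(u', u)} ∪ R) p {K : Finset (Sym2 V) | u' ∈ cl K g} = p s(u', u) * PrW R p {K : Finset (Sym2 V) | u ∈ cl K g}
    ∧ PrW ({s(u', u)} ∪ R) p {K : Finset (Sym2 V) | v ∈ cl K g} = PrW R p {K : Finset (Sym2 V) | v ∈ cl K g}
    ∧ PrW ({s(u', u)} ∪ R) p {K : Finset (Sym2 V) | u' ∈ cl K g ∧ v ∈ cl K g}
        = p s(u', u) * PrW R p {K : Finset (Sym2 V) | u ∈ cl K g ∧ v ∈ cl K g}
    ∧ PrW ({s(u', u)} ∪ R) p {K : Finset (Sym2 V) | u' ∉ cl K g ∧ v ∈ cl K u'}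
        = p s(u', u) * PrW R p {K : Finset (Sym2 V) | u ∉ cl K g ∧ v ∈ cl K u} := by
  obtain ⟨h1, h2, h3, h4⟩ := rail_piece p g u u' hu'g hu'u hug
  have hdisj := rail_disjoint R u u' hu'
  have hsep := rail_sep R g u u' hu'
  have hu : ∀ e ∈ R, u' ∈ e → u' = u := fun e he h => absurd h (hu' e he)
  have hv := rail_off u v u' hu'v huv
  refine ⟨?_, ?_, ?_, ?_⟩
  · rw [series_p p {s(u', u)} R hdisj g u u' hsep hu hu'g, h1, h4, zero_add]
  · rw [series_pi p {s(u', u)} R hdisj g u v hsep hv hvg, h2, mul_zero, add_zero]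
  · rw [series_tau p {s(u', u)} R hdisj g u u' v hsep hu hv hu'g hvg, h1, h3, h4, both_comm p R g u v]
    ring
  · rw [series_m p {s(u', u)} R hdisj g u u' v hsep hu hv hu'g hu'v, h4, m_event_comm p R g u v]

/-- **Rail at the port `v`**: for a fresh vertex `v'` (off `R`, `≠ g, u, v`) and the rail edge `s(v', v)` of weight `c`, the four numbers of
`(g; u, v')` on `R ∪ {s(v', v)}` are `(p, c·π, c·τ, c·m)`. [this work] -/
theorem rail_v (p : Sym2 V → ℝ) (R : Finset (Sym2 V)) (g u v v' : V) (hv' : ∀ e ∈ R, v' ∉ e) (hv'g : v' ≠ g) (hv'v : v' ≠ v)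
    (hv'u : v' ≠ u) (hug : u ≠ g) (hvg : v ≠ g) (huv : u ≠ v) :
    PrW (R ∪ {s(v', v)}) p {K : Finset (Sym2 V) | u ∈ cl K g} = PrW R p {K : Finset (Sym2 V) | u ∈ cl K g}
    ∧ PrW (R ∪ {s(v', v)}) p {K : Finset (Sym2 V) | v' ∈ cl K g} = p s(v', v) * PrW R p {K : Finset (Sym2 V) | v ∈ cl K g}
    ∧ PrW (R ∪ {s(v', v)}) p {K : Finset (Sym2 V) | u ∈ cl K g ∧ v' ∈ cl K g}
        = p s(v', v) * PrW R p {K : Finset (Sym2 V) | u ∈ cl K g ∧ v ∈ cl K g}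
    ∧ PrW (R ∪ {s(v', v)}) p {K : Finset (Sym2 V) | u ∉ cl K g ∧ v' ∈ cl K u}
        = p s(v', v) * PrW R p {K : Finset (Sym2 V) | u ∉ cl K g ∧ v ∈ cl K u} := by
  obtain ⟨h1, h2, h3, h4⟩ := rail_piece p g v v' hv'g hv'v hvg
  have hdisj : Disjoint R ({s(v', v)} : Finset (Sym2 V)) := (rail_disjoint R v v' hv').symm
  have hsep : ∀ x : V, (∃ e ∈ R, x ∈ e) → (∃ e ∈ ({s(v', v)} : Finset (Sym2 V)), x ∈ e) → (x = g ∨ x = v) :=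
    fun x h1 h2 => rail_sep R g v v' hv' x h2 h1
  have hv : ∀ e ∈ R, v' ∈ e → v' = v := fun e he h => absurd h (hv' e he)
  have hu := rail_off v u v' hv'u huv.symm
  refine ⟨?_, ?_, ?_, ?_⟩
  · rw [series_p p R {s(v', v)} hdisj g v u hsep hu hug, h2, mul_zero, add_zero]
  · rw [series_pi p R {s(v', v)} hdisj g v v' hsep hv hv'g, h1, h4, zero_add]
  · rw [series_tau p R {s(v', v)} hdisj g v u v' hsep hu hv hug hv'g, h1, h3, h4]
    ring
  · rw [series_m p R {s(v', v)} hdisj g v u v' hsep hu hv hug hv'u.symm, h4, mul_comm]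

/-! ### A rung between the ports -/

/-- **Rung between the ports**: for the new edge `s(u, v)` of weight `w` (`g ∉ {u, v}`, `s(u,v) ∉ R`), the four numbers of `(g; u, v)` on
`R ∪ {s(u,v)}` are `p + w(π − τ)`, `π + w(p − τ)`, `τ + w(p + π − 2τ)`, `m + w(1 − p − π + τ − m)` — the shortcut map of `shortcut_parallel`
(union lemma `glued_cell_*` with the `g`-free one-edge piece). [this work] -/
theorem rung (p : Sym2 V → ℝ) (R : Finset (Sym2 V)) (g u v : V) (he : s(u, v) ∉ R) (hug : u ≠ g) (hvg : v ≠ g) (huv : u ≠ v) :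
    PrW (R ∪ {s(u, v)}) p {K : Finset (Sym2 V) | u ∈ cl K g}
        = PrW R p {K : Finset (Sym2 V) | u ∈ cl K g}
          + p s(u, v) * (PrW R p {K : Finset (Sym2 V) | v ∈ cl K g} - PrW R p {K : Finset (Sym2 V) | u ∈ cl K g ∧ v ∈ cl K g})
    ∧ PrW (R ∪ {s(u, v)}) p {K : Finset (Sym2 V) | v ∈ cl K g}
        = PrW R p {K : Finset (Sym2 V) | v ∈ cl K g}
          + p s(u, v) * (PrW R p {K : Finset (Sym2 V) | u ∈ cl K g} - PrW R p {K : Finset (Sym2 V) | u ∈ cl K g ∧ v ∈ cl K g})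
    ∧ PrW (R ∪ {s(u, v)}) p {K : Finset (Sym2 V) | u ∈ cl K g ∧ v ∈ cl K g}
        = PrW R p {K : Finset (Sym2 V) | u ∈ cl K g ∧ v ∈ cl K g}
          + p s(u, v) * (PrW R p {K : Finset (Sym2 V) | u ∈ cl K g} + PrW R p {K : Finset (Sym2 V) | v ∈ cl K g}
              - 2 * PrW R p {K : Finset (Sym2 V) | u ∈ cl K g ∧ v ∈ cl K g})
    ∧ PrW (R ∪ {s(u, v)}) p {K : Finset (Sym2 V) | u ∉ cl K g ∧ v ∈ cl K u}
        = PrW R p {K : Finset (Sym2 V) | u ∉ cl K g ∧ v ∈ cl K u}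
          + p s(u, v) * (1 - PrW R p {K : Finset (Sym2 V) | u ∈ cl K g} - PrW R p {K : Finset (Sym2 V) | v ∈ cl K g}
              + PrW R p {K : Finset (Sym2 V) | u ∈ cl K g ∧ v ∈ cl K g} - PrW R p {K : Finset (Sym2 V) | u ∉ cl K g ∧ v ∈ cl K u}) := by
  have hdisj : Disjoint R ({s(u, v)} : Finset (Sym2 V)) := Finset.disjoint_singleton_right.2 he
  have hsep : ∀ x : V, (∃ e ∈ R, x ∈ e) → (∃ e ∈ ({s(u, v)} : Finset (Sym2 V)), x ∈ e) → (x = g ∨ x = u ∨ x = v) := by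
    rintro x _ ⟨e, he', hxe⟩
    rw [Finset.mem_singleton] at he'
    subst he'
    rcases Sym2.mem_iff.1 hxe with rfl | rfl
    · exact Or.inr (Or.inl rfl)
    · exact Or.inr (Or.inr rfl)
  have hD : ∀ f ∈ ({s(u, v)} : Finset (Sym2 V)), g ∉ f := fun f hf hg => by
    rw [Finset.mem_singleton] at hf
    subst hf
    rcases Sym2.mem_iff.1 hg with h | h
    · exact hug h.symm
    · exact hvg h.symm
  have hsum := cells_sum_eq_one p R g u v
  -- the union's cells in terms of the cells of `R` and `w`
  have eB := glued_cell_ab p R {s(u, v)} hdisj g u v hsep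
  have eA := glued_cell_ac p R {s(u, v)} hdisj g u v hsep
  have eM := glued_cell_bc p R {s(u, v)} hdisj g u v hsep
  have eT := glued_cell_three p R {s(u, v)} hdisj g u v hsep
  simp only [afree_cell_zero p _ g u v hug hvg hD, afree_cell_ab p _ g u v hug hD, afree_cell_ac p _ g u v hvg hD,
    afree_cell_bc p _ g u v hug hvg hD, afree_cell_three p _ g u v hug hD, PrW_not_conn_eq p _ u v, edge_conn p u v huv] at eB eA eM eT
  rw [conn_eq_cells_b p (R ∪ {s(u, v)}) g u v, conn_eq_cells_c p (R ∪ {s(u, v)}) g u v, m_event_eq_cell p (R ∪ {s(u, v)}) g u v,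
    conn_eq_cells_b p R g u v, conn_eq_cells_c p R g u v, m_event_eq_cell p R g u v, eB, eA, eM, eT]
  refine ⟨by ring, by ring, by ring, ?_⟩
  linear_combination (p s(u, v)) * hsum

end APL

end Summit.CriticalPhenomena.PercolationContinuityZ3.Theorems
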